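import Mathlib.Combinatorics.SimpleGraph.LineGraph
import Mathlib.Combinatorics.SimpleGraph.Coloring.Vertex
import Literature.Combinatorics.SimpleGraph.BrinkmannTuckerVanCleemput2021.ClassTwo
import HarnessLib

/-!
# `G70` has chromatic index 4

`…ClassTwo` (same directory) shows that the cubic graph `G70` has no proper 3-edge-colouring.  This
module adds an explicit proper 4-edge-colouring (`slotColour`, found by backtracking; colour classes
of sizes `30, 33, 28, 14`), so that the chromatic number of Mathlib's line graph `G70.lineGraph` —
the chromatic index of `G70` — is exactly `4` (`chromaticIndex_eq_four`), as Vizing's theorem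
predicts for a class-2 cubic graph (Vizing's theorem itself is not in Mathlib and is not used).

Provenance: refutations bundle `papers/_cross/refutations` (H21 seat pub-refute-2, 2026-08-18); the
table was GENERATED by that seat's `g16/fourcol.py`; written for the tree under the Lean-in-tree
rule (human 2026-08-18).
-/

namespace Literature.Combinatorics.SimpleGraph.BrinkmannTuckerVanCleemput2021

open _root_.SimpleGraph

/-- The colour table: entry `v` lists the colours of the three edges `v — rot v 0, 1, 2`.
[folklore] -/
def slotTable : List (Fin 4 × Fin 4 × Fin 4) :=
  [(0, 1, 2), (2, 1, 0), (0, 1, 2), (2, 1, 0), (2, 0, 1), (1, 0, 2), (1, 0, 2), (1, 0, 2),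
   (2, 1, 0), (2, 0, 1), (2, 1, 0), (0, 1, 2), (2, 0, 1), (1, 0, 2), (0, 1, 2), (0, 1, 2),
   (3, 1, 0), (3, 1, 2), (1, 0, 3), (3, 0, 2), (3, 2, 1), (0, 1, 3), (0, 1, 3), (0, 1, 3),
   (0, 1, 2), (2, 1, 0), (0, 1, 2), (2, 1, 0), (2, 0, 1), (0, 1, 2), (2, 0, 1), (3, 1, 0),
   (0, 2, 1), (2, 0, 1), (1, 0, 3), (3, 0, 1), (2, 1, 0), (2, 3, 1), (1, 0, 2), (1, 0, 2),
   (0, 2, 1), (3, 1, 2), (1, 3, 2), (3, 0, 2), (2, 1, 3), (1, 0, 2), (0, 1, 3), (0, 1, 3),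
   (0, 1, 3), (2, 1, 0), (0, 1, 2), (2, 1, 0), (2, 0, 1), (0, 1, 2), (2, 0, 1), (1, 2, 0),
   (0, 2, 1), (1, 0, 2), (1, 0, 3), (3, 0, 1), (2, 1, 0), (2, 3, 1), (1, 0, 2), (0, 3, 1),
   (3, 2, 1), (3, 0, 2), (2, 1, 3), (3, 0, 2), (2, 1, 3), (1, 0, 2)]

/-- The colour of the edge from `v` along rotation slot `i`. [folklore] -/
def slotColour (v : Fin 70) (i : Fin 3) : Fin 4 :=
  let t := slotTable.getD v.val (0, 0, 0)
  if i = 0 then t.1 else if i = 1 then t.2.1 else t.2.2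

/-- The colour of an ordered pair `(u, v)`: the slot colour of `v` in the rotation of `u`
(junk `0` if `v` is not a neighbour of `u`). [folklore] -/
def pairColour (u v : Fin 70) : Fin 4 :=
  if rot u 0 = v then slotColour u 0 else if rot u 1 = v then slotColour u 1
    else if rot u 2 = v then slotColour u 2 else 0

/-- Kernel fact: the pair colouring is symmetric (both ends of an edge record the same colour;
non-edges get `0` from both sides). [folklore] -/
theorem pairColour_symm : ∀ u v : Fin 70, pairColour u v = pairColour v u := by
  decide +kernel

/-- The edge colouring on unordered pairs. [folklore] -/
def edgeColour : Sym2 (Fin 70) → Fin 4 :=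
  Sym2.lift ⟨pairColour, pairColour_symm⟩

/-- Kernel fact: at every vertex the three incident edges receive three different colours.
[folklore] -/
theorem edgeColour_proper_at : ∀ (v : Fin 70) (i j : Fin 3), i ≠ j →
    edgeColour s(v, rot v i) ≠ edgeColour s(v, rot v j) := by
  decide +kernel

/-- Two distinct edges of `G70` through a common vertex receive different colours. [folklore] -/
theorem edgeColour_proper {e f : Sym2 (Fin 70)} (he : e ∈ G70.edgeSet) (hf : f ∈ G70.edgeSet)
    (hne : e ≠ f) {v : Fin 70} (hve : v ∈ e) (hvf : v ∈ f) : edgeColour e ≠ edgeColour f := by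
  obtain ⟨b, rfl⟩ := Sym2.mem_iff_exists.1 hve
  obtain ⟨d, rfl⟩ := Sym2.mem_iff_exists.1 hvf
  rw [mem_edgeSet] at he hf
  obtain ⟨i, rfl⟩ := exists_rot_of_adj v b he
  obtain ⟨j, rfl⟩ := exists_rot_of_adj v d hf
  exact edgeColour_proper_at v i j fun h => hne (h ▸ rfl)

/-- The explicit proper 4-edge-colouring of `G70`, as a colouring of its line graph. [folklore] -/
def fourEdgeColouring : G70.lineGraph.Coloring (Fin 4) :=
  Coloring.mk (fun e => edgeColour e.1) fun h => by
    obtain ⟨hne, v, hve, hvf⟩ := lineGraph_adj_iff_exists.1 h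
    exact edgeColour_proper (Subtype.coe_prop _) (Subtype.coe_prop _)
      (fun h' => hne (Subtype.ext h')) hve hvf

/-- `G70` is 4-edge-colourable. [folklore] -/
theorem colorable_four : G70.lineGraph.Colorable 4 :=
  ⟨fourEdgeColouring⟩

/-- **The chromatic index of `G70` is `4`**: its line graph has chromatic number `4`
(4-edge-colourable by `colorable_four`, not 3-edge-colourable by `…ClassTwo.not_colorable_three`).
[cite: BrinkmannTuckerVancleemput2021, §3.1] -/
theorem chromaticIndex_eq_four : G70.lineGraph.chromaticNumber = 4 :=
  chromaticNumber_eq_iff_colorable_not_colorable.2 ⟨colorable_four, not_colorable_three⟩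

end Literature.Combinatorics.SimpleGraph.BrinkmannTuckerVanCleemput2021
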